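import Literature.NumberTheory.EllipticCurves.TowerPresentedSubquotientProofs
import Literature.NumberTheory.GaloisRepresentations.StrictSubgroupFunctorialityProofs
import Literature.NumberTheory.GaloisRepresentations.PPrimaryDevissage
import Literature.NumberTheory.GaloisRepresentations.DiscreteCochainsLongExact
import HarnessLib

/-!
# Sub- and quotient towers of a presented tower: the first `H¹`-consequences — strict cores along the family,
# detection through the quotient tower, lifting through the sub-tower (theorems only)

`Proofs` file (theorems only; no definition, no named fact, no instance, no `sorry`).  Topic `NumberTheory/EllipticCurves`
(cell `pub/bsd-print-x9`, D1 road, brick (B1) of `HOME/p1/H4-EXACT-AT-P-PLAN-x10b-p1-g8.md`, second half; sequel to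
`TowerPresentedSubquotientProofs` (the restricted family `g a b` on `Fil j` and the induced family `q a b` on `W j ⧸ Fil j` of a
presented tower `f a b` on `W j`, with their eight identities and short exact sequences) and to
`StrictSubgroupFunctorialityProofs` (x10b-p1-w6 g0)).

Howard 2004, §3.1 / Def. 3.2.6 / Lemma 3.2.7 [arXiv:1202.6340 p. 15 L56–66, p. 16]: the ordinary core at `v ∣ p` is the STRICT
condition `H¹_str(W_j, Fil_v W_j) = ker (H¹(K_v, W_j) → H¹(K_v, W_j ⧸ Fil_v W_j)) = im (H¹(K_v, Fil_v W_j) → H¹(K_v, W_j))`.  For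
the consumers of (B1) ((B4)/(B6) of the H.4 (Exact)-at-`p` plan, (H5B-P) = H.5(b) at `v ∣ p`) this file records, for ANY
field `F` and any presented tower with a compatible saturated filtration:

* `map_strictSubgroup_le_of_family` — the strict cores are carried into each other by every `H¹(f a b)`;
* `mem_strictSubgroup_iff_exists_map_subtypeHom_eq` — `H¹_str(W, Fil) = im H¹(F, Fil)`;
* `quotientMap_map_eq_map_quotientMap`, `map_subtypeHom_eq_subtypeHom_map` — naturality of `H¹(mkQ)`, `H¹(subtype)` along
  the families `q`, `g`;
* **DETECTION** `mem_strictSubgroup_of_map_mem` — `H¹(f a b) x ∈ H¹_str(W b) → x ∈ H¹_str(W a)` when `H¹(q a b)` is injective,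
  and `map_quotFamily_injective_of_forall_invariant_eq_zero` — that injectivity for the up-maps `q ℓ (ℓ+n)` when the level
  `W n ⧸ Fil n` has no non-zero `Γ_F`-invariant (exactness `H⁰(gr n) →δ₀ H¹(gr ℓ) → H¹(gr (ℓ+n))`); so (non-anomalous `v ∣ p`:
  `H⁰(K_v, gr_v W_n) = 0`) the saturation of the ordinary tower does not enlarge the cores;
* **LIFTING** `map_subFamily_surjective_of_subsingleton` — `H¹(g (ℓ+n) n)` is onto when `H²(F, Fil ℓ) = 0` (exactness
  `H¹(Fil (ℓ+n)) → H¹(Fil n) →δ₁ H²(Fil ℓ)`), and `exists_mem_strictSubgroup_map_eq_of_subsingleton` — core classes lift along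
  the reductions; so (non-anomalous `v ∣ p`: `H²(K_v, Fil_v W_ℓ) = 0` by local duality) every core class extends to a compatible
  family of core classes.

Everything is [folklore] long-exact-sequence bookkeeping (tree `IsSES`: `exists_δ₀_eq_of_map_one_eq_zero`,
`exists_map_one_eq_of_δ₁_eq_zero`, `isSES_subtype_mkQ`), recorded against Howard §3.1–3.2 and Serre I §2.2.  Seat
`bsd-line-x10b-p1-w6` g2.  No summit statement is proved; BSD is not proved by any of this.

References: [Howard2004HeegnerKolyvagin] B. Howard, Compositio Math. 140 (2004), §3.1, Def. 3.2.5–3.2.6, Lemma 3.2.7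
(arXiv:1202.6340 p. 15–16); [SerreGaloisCohomology1997] I §2.2; [GreenbergLNM1716] §2.
-/

noncomputable section

open CategoryTheory
open scoped ContRepresentation

namespace Literature.NumberTheory.EllipticCurves

namespace Tower

open Literature.NumberTheory.GaloisRepresentations

variable {F : Type} [Field F]
variable {W : ℕ → Type} [∀ j, AddCommGroup (W j)] [∀ j, TopologicalSpace (W j)]
  [∀ j, DiscreteTopology (W j)]
variable {ρ : ∀ j, DiscreteGaloisModule F (W j)}
variable {f : ∀ a b, (ρ a).toContRepresentation →ⁱL (ρ b).toContRepresentation}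
variable {Fil : ∀ j, Submodule ℤ (W j)}
variable {hΓ : ∀ j (σ : Field.absoluteGaloisGroup F), Fil j ≤ (Fil j).comap (ρ j σ)}

/-! ## `H¹`-consequences: the strict cores along the family; detection through the quotient tower; lifting through the
sub-tower -/

section Cohomology

/-- **The strict cores are carried into each other by every map of the family**: `H¹(f a b)` maps
`H¹_str(W a, Fil a) = ker (H¹(F, W a) → H¹(F, W a ⧸ Fil a))` into `H¹_str(W b, Fil b)` (tree `map_strictSubgroup_le`).
[cite: Howard2004HeegnerKolyvagin, §3.1 and Def. 3.2.6 (arXiv p. 15 L56–66, p. 16)] [folklore] -/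
theorem map_strictSubgroup_le_of_family (hmap : ∀ a b, ∀ w ∈ Fil a, f a b w ∈ Fil b) (a b : ℕ) :
    ((ρ a).strictSubgroup (Fil a) (hΓ a)).map (galoisCohomology.map (f a b) 1) ≤ (ρ b).strictSubgroup (Fil b) (hΓ b) :=
  DiscreteGaloisModule.map_strictSubgroup_le (f a b) (Fil a) (hΓ a) (Fil b) (hΓ b) (hmap a b)

/-- **The strict core is the image of `H¹(F, Fil) → H¹(F, W)`** (exactness of `H¹(Fil) → H¹(W) → H¹(W ⧸ Fil)`, tree
`isSES_subtype_mkQ`). [cite: Howard2004HeegnerKolyvagin, §3.1 (arXiv p. 15 L62–66: H¹_ord = im H¹(K_v, Fil_v ·))]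
[cite: SerreGaloisCohomology1997, Ch. I §2.2] -/
theorem mem_strictSubgroup_iff_exists_map_subtypeHom_eq (j : ℕ) (x : galoisCohomology (ρ j) 1) :
    x ∈ (ρ j).strictSubgroup (Fil j) (hΓ j) ↔
      ∃ y : galoisCohomology ((ρ j).subrepresentation (Fil j) (hΓ j)) 1,
        cohomologyMap (subtypeHom (ρ j) (Fil j) (hΓ j)) 1 y = x := by
  constructor
  · intro hx
    exact (isSES_subtype_mkQ (ρ j) (Fil j) (hΓ j)).exists_map_one_eq_of_map_one_eq_zero x hx
  · rintro ⟨y, rfl⟩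
    exact (isSES_subtype_mkQ (ρ j) (Fil j) (hΓ j)).cohomologyMap_comp_apply_eq_zero' 1 y

/-- **Naturality of `H¹(mkQ)` along the family**: `H¹(mkQ_b) ∘ H¹(f a b) = H¹(q a b) ∘ H¹(mkQ_a)`.
[cite: SerreGaloisCohomology1997, Ch. I §2.2] [folklore] -/
theorem quotientMap_map_eq_map_quotientMap
    {q : ∀ a b, ((ρ a).quotient (Fil a) (hΓ a)).toContRepresentation →ⁱL
      ((ρ b).quotient (Fil b) (hΓ b)).toContRepresentation}
    (hq : ∀ a b (x : W a), q a b (Submodule.Quotient.mk x) = Submodule.Quotient.mk (f a b x)) (a b : ℕ)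
    (x : galoisCohomology (ρ a) 1) :
    (ρ b).quotientMap (Fil b) (hΓ b) 1 (galoisCohomology.map (f a b) 1 x) =
      galoisCohomology.map (q a b) 1 ((ρ a).quotientMap (Fil a) (hΓ a) 1 x) := by
  obtain ⟨φ, rfl⟩ := oneCocycleClass_surjective (ρ a).toTopRep x
  change ContinuousCohomology.map _ _ 1 (ContinuousCohomology.map _ _ 1 _) =
    ContinuousCohomology.map _ _ 1 (ContinuousCohomology.map _ _ 1 _)
  rw [map_oneCocycleClass, map_oneCocycleClass, map_oneCocycleClass, map_oneCocycleClass]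
  exact congrArg _ (Subtype.ext (ContinuousMap.ext fun σ ↦ (hq a b _).symm))

/-- **Naturality of `H¹(subtype)` along the family**: `H¹(f a b) ∘ H¹(ι_a) = H¹(ι_b) ∘ H¹(g a b)`.
[cite: SerreGaloisCohomology1997, Ch. I §2.2] [folklore] -/
theorem map_subtypeHom_eq_subtypeHom_map
    {g : ∀ a b, ((ρ a).subrepresentation (Fil a) (hΓ a)).toContRepresentation →ⁱL
      ((ρ b).subrepresentation (Fil b) (hΓ b)).toContRepresentation}
    (hg : ∀ a b (x : Fil a), (g a b x : W b) = f a b x) (a b : ℕ)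
    (y : galoisCohomology ((ρ a).subrepresentation (Fil a) (hΓ a)) 1) :
    galoisCohomology.map (f a b) 1 (cohomologyMap (subtypeHom (ρ a) (Fil a) (hΓ a)) 1 y) =
      cohomologyMap (subtypeHom (ρ b) (Fil b) (hΓ b)) 1 (galoisCohomology.map (g a b) 1 y) := by
  obtain ⟨φ, rfl⟩ := oneCocycleClass_surjective _ y
  change ContinuousCohomology.map _ _ 1 (ContinuousCohomology.map _ _ 1 _) =
    ContinuousCohomology.map _ _ 1 (ContinuousCohomology.map _ _ 1 _)
  rw [map_oneCocycleClass, map_oneCocycleClass, map_oneCocycleClass, map_oneCocycleClass]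
  exact congrArg _ (Subtype.ext (ContinuousMap.ext fun σ ↦ (hg a b _).symm))

/-- **DETECTION through the quotient tower**: if `H¹(q a b)` is injective, a class whose image under `H¹(f a b)` lies in the
strict core of `W b` lies in the strict core of `W a` (`mkQ_b ∘ f a b = q a b ∘ mkQ_a` on `H¹`). For the up-maps
`q ℓ (ℓ+n)` the injectivity is `map_quotFamily_injective_of_forall_invariant_eq_zero`.
[cite: Howard2004HeegnerKolyvagin, §3.1 and Lemma 3.2.7 (arXiv p. 15–16)] [folklore] -/
theorem mem_strictSubgroup_of_map_mem
    {q : ∀ a b, ((ρ a).quotient (Fil a) (hΓ a)).toContRepresentation →ⁱL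
      ((ρ b).quotient (Fil b) (hΓ b)).toContRepresentation}
    (hq : ∀ a b (x : W a), q a b (Submodule.Quotient.mk x) = Submodule.Quotient.mk (f a b x)) {a b : ℕ}
    (hinjH : Function.Injective (galoisCohomology.map (q a b) 1)) {x : galoisCohomology (ρ a) 1}
    (hx : galoisCohomology.map (f a b) 1 x ∈ (ρ b).strictSubgroup (Fil b) (hΓ b)) :
    x ∈ (ρ a).strictSubgroup (Fil a) (hΓ a) := by
  rw [DiscreteGaloisModule.mem_strictSubgroup_iff] at hx ⊢
  apply hinjH
  rw [map_zero, ← quotientMap_map_eq_map_quotientMap hq, hx]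

/-- **Injectivity of `H¹` of an up-map of the quotient tower from the vanishing of the invariants of its cokernel**: if
`W n ⧸ Fil n` has no non-zero `Γ_F`-fixed vector then `H¹(q ℓ (ℓ+n)) : H¹(F, W ℓ ⧸ Fil ℓ) → H¹(F, W (ℓ+n) ⧸ Fil (ℓ+n))` is
injective — exactness `H⁰(gr n) →δ₀ H¹(gr ℓ) → H¹(gr (ℓ+n))` of `0 → gr ℓ → gr (ℓ+n) → gr n → 0`.
[cite: Howard2004HeegnerKolyvagin, Lemma 3.2.7 (arXiv p. 16)] [cite: SerreGaloisCohomology1997, Ch. I §2.2] -/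
theorem map_quotFamily_injective_of_forall_invariant_eq_zero
    {q : ∀ a b, ((ρ a).quotient (Fil a) (hΓ a)).toContRepresentation →ⁱL
      ((ρ b).quotient (Fil b) (hΓ b)).toContRepresentation}
    (hq : ∀ a b (x : W a), q a b (Submodule.Quotient.mk x) = Submodule.Quotient.mk (f a b x))
    (hmap : ∀ a b, ∀ w ∈ Fil a, f a b w ∈ Fil b) (hsurj : ∀ ℓ n, Function.Surjective (f (ℓ + n) n))
    (hex : ∀ ℓ n (y : W (ℓ + n)), f (ℓ + n) n y = 0 ↔ ∃ x, f ℓ (ℓ + n) x = y)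
    (honto : ∀ ℓ n, ∀ w' ∈ Fil n, ∃ w ∈ Fil (ℓ + n), f (ℓ + n) n w = w')
    (hsat : ∀ ℓ n (w : W ℓ), f ℓ (ℓ + n) w ∈ Fil (ℓ + n) → w ∈ Fil ℓ) (ℓ n : ℕ)
    (hinv : ∀ v : W n ⧸ Fil n, (∀ σ : Field.absoluteGaloisGroup F, (ρ n).quotient (Fil n) (hΓ n) σ v = v) → v = 0) :
    Function.Injective (galoisCohomology.map (q ℓ (ℓ + n)) 1) := by
  haveI : CompactSpace (Field.absoluteGaloisGroup F) := absoluteGaloisGroup_compactSpace F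
  have hS := isSES_quotFamily hq hmap hsurj hex honto hsat ℓ n
  refine (injective_iff_map_eq_zero _).mpr fun x hx ↦ ?_
  rw [galoisCohomology.map_eq_cohomologyMap_apply] at hx
  obtain ⟨v, hv⟩ := hS.exists_δ₀_eq_of_map_one_eq_zero x hx
  have hv0 : v = 0 := Subtype.ext (hinv v.1 fun σ ↦ v.2 σ)
  rw [← hv, hv0, map_zero]
  rfl

/-- **LIFTING through the sub-tower**: if `H²(F, Fil ℓ) = 0` then `H¹(g (ℓ+n) n) : H¹(F, Fil (ℓ+n)) → H¹(F, Fil n)` is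
surjective — exactness `H¹(Fil (ℓ+n)) → H¹(Fil n) →δ₁ H²(Fil ℓ)` of `0 → Fil ℓ → Fil (ℓ+n) → Fil n → 0`.
[cite: Howard2004HeegnerKolyvagin, Lemma 3.2.7 (arXiv p. 16)] [cite: SerreGaloisCohomology1997, Ch. I §2.2] -/
theorem map_subFamily_surjective_of_subsingleton
    {g : ∀ a b, ((ρ a).subrepresentation (Fil a) (hΓ a)).toContRepresentation →ⁱL
      ((ρ b).subrepresentation (Fil b) (hΓ b)).toContRepresentation}
    (hg : ∀ a b (x : Fil a), (g a b x : W b) = f a b x)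
    (hinj : ∀ ℓ n, Function.Injective (f ℓ (ℓ + n)))
    (hex : ∀ ℓ n (y : W (ℓ + n)), f (ℓ + n) n y = 0 ↔ ∃ x, f ℓ (ℓ + n) x = y)
    (honto : ∀ ℓ n, ∀ w' ∈ Fil n, ∃ w ∈ Fil (ℓ + n), f (ℓ + n) n w = w')
    (hsat : ∀ ℓ n (w : W ℓ), f ℓ (ℓ + n) w ∈ Fil (ℓ + n) → w ∈ Fil ℓ) (ℓ n : ℕ)
    (h2 : Subsingleton (continuousCohomology 2 ((ρ ℓ).subrepresentation (Fil ℓ) (hΓ ℓ)).toTopRep)) :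
    Function.Surjective (galoisCohomology.map (g (ℓ + n) n) 1) := by
  haveI : CompactSpace (Field.absoluteGaloisGroup F) := absoluteGaloisGroup_compactSpace F
  have hS := isSES_subFamily hg hinj hex honto hsat ℓ n
  intro x
  obtain ⟨y, hy⟩ := hS.exists_map_one_eq_of_δ₁_eq_zero x (Subsingleton.elim _ _)
  exact ⟨y, by rw [galoisCohomology.map_eq_cohomologyMap_apply]; exact hy⟩

/-- **Core classes lift along the reductions when `H²(F, Fil ℓ) = 0`**: every class of the strict core `H¹_str(W n, Fil n)`
is the reduction `H¹(f (ℓ+n) n) z` of a class `z` of the strict core `H¹_str(W (ℓ+n), Fil (ℓ+n))` (write it as the image of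
`H¹(F, Fil n)`, lift through the sub-tower, push forward). With `H²(K_v, Fil_v W₁) = 0` (non-anomalous `v ∣ p`) this makes
the tower of ordinary cores SURJECTIVE, so every core class extends to a compatible family of core classes.
[cite: Howard2004HeegnerKolyvagin, §3.1 and Lemma 3.2.7 (arXiv p. 15–16)] [cite: SerreGaloisCohomology1997, Ch. I §2.2] -/
theorem exists_mem_strictSubgroup_map_eq_of_subsingleton
    {g : ∀ a b, ((ρ a).subrepresentation (Fil a) (hΓ a)).toContRepresentation →ⁱL
      ((ρ b).subrepresentation (Fil b) (hΓ b)).toContRepresentation}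
    (hg : ∀ a b (x : Fil a), (g a b x : W b) = f a b x)
    (hinj : ∀ ℓ n, Function.Injective (f ℓ (ℓ + n)))
    (hex : ∀ ℓ n (y : W (ℓ + n)), f (ℓ + n) n y = 0 ↔ ∃ x, f ℓ (ℓ + n) x = y)
    (honto : ∀ ℓ n, ∀ w' ∈ Fil n, ∃ w ∈ Fil (ℓ + n), f (ℓ + n) n w = w')
    (hsat : ∀ ℓ n (w : W ℓ), f ℓ (ℓ + n) w ∈ Fil (ℓ + n) → w ∈ Fil ℓ) (ℓ n : ℕ)
    (h2 : Subsingleton (continuousCohomology 2 ((ρ ℓ).subrepresentation (Fil ℓ) (hΓ ℓ)).toTopRep))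
    {y : galoisCohomology (ρ n) 1} (hy : y ∈ (ρ n).strictSubgroup (Fil n) (hΓ n)) :
    ∃ z ∈ (ρ (ℓ + n)).strictSubgroup (Fil (ℓ + n)) (hΓ (ℓ + n)), galoisCohomology.map (f (ℓ + n) n) 1 z = y := by
  obtain ⟨η, rfl⟩ := (mem_strictSubgroup_iff_exists_map_subtypeHom_eq n y).mp hy
  obtain ⟨η', rfl⟩ := map_subFamily_surjective_of_subsingleton hg hinj hex honto hsat ℓ n h2 η
  exact ⟨cohomologyMap (subtypeHom (ρ (ℓ + n)) (Fil (ℓ + n)) (hΓ (ℓ + n))) 1 η',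
    (mem_strictSubgroup_iff_exists_map_subtypeHom_eq (ℓ + n) _).mpr ⟨η', rfl⟩,
    map_subtypeHom_eq_subtypeHom_map hg (ℓ + n) n η'⟩

/-! ### Compatible families of core classes are images of compatible families of the sub-tower (Kőnig) -/

/-- The image under the levelwise `H¹(ι_j)` of a compatible family of the sub-tower `H¹(F, Fil j)` is a compatible family of
the tower `H¹(F, W j)` lying in the strict cores at every level.
[cite: Howard2004HeegnerKolyvagin, §3.1 and Def. 3.2.6 (arXiv p. 15–16)] [cite: SerreGaloisCohomology1997, Ch. I §2.2] -/
theorem map_subtypeHom_mem_compatibleFamilies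
    {g : ∀ a b, ((ρ a).subrepresentation (Fil a) (hΓ a)).toContRepresentation →ⁱL
      ((ρ b).subrepresentation (Fil b) (hΓ b)).toContRepresentation}
    (hg : ∀ a b (x : Fil a), (g a b x : W b) = f a b x)
    {η : Π j, galoisCohomology ((ρ j).subrepresentation (Fil j) (hΓ j)) 1}
    (hη : η ∈ compatibleFamilies (H := fun j ↦ galoisCohomology ((ρ j).subrepresentation (Fil j) (hΓ j)) 1)
      (fun j ↦ galoisCohomology.map (g (j + 1) j) 1)) :
    (fun j ↦ cohomologyMap (subtypeHom (ρ j) (Fil j) (hΓ j)) 1 (η j)) ∈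
        compatibleFamilies (H := fun j ↦ galoisCohomology (ρ j) 1) (fun j ↦ galoisCohomology.map (f (j + 1) j) 1) ∧
      ∀ j, cohomologyMap (subtypeHom (ρ j) (Fil j) (hΓ j)) 1 (η j) ∈ (ρ j).strictSubgroup (Fil j) (hΓ j) := by
  refine ⟨(mem_compatibleFamilies_iff _ _).mpr fun j ↦ ?_,
    fun j ↦ (mem_strictSubgroup_iff_exists_map_subtypeHom_eq j _).mpr ⟨η j, rfl⟩⟩
  rw [map_subtypeHom_eq_subtypeHom_map hg (j + 1) j, (mem_compatibleFamilies_iff _ η).mp hη j]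

/-- **A compatible family of core classes is the image of a compatible family of the sub-tower** (memo §1(b):
`C∞ = ι(lim_j H¹(F, Fil j))`): if `x ∈ lim_j H¹(F, W j)` has `x j ∈ H¹_str(W j, Fil j)` for every `j`, then `x j = H¹(ι_j) η_j`
for a family `η` compatible under the reductions `H¹(g (j+1) j)` of the sub-tower — Kőnig's lemma on the finite nonempty
fibres `{η_j | H¹(ι_j) η_j = x j}`, which the reductions map into each other by naturality.  (Finiteness of the `H¹(F, Fil j)`:
finite modules over a local field.) [cite: Howard2004HeegnerKolyvagin, §3.1, Def. 3.2.6 and Lemma 3.2.7 (arXiv p. 15–16)]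
[cite: SerreGaloisCohomology1997, Ch. I §2.2 (limits of finite modules)] -/
theorem exists_mem_compatibleFamilies_sub_of_forall_mem_strictSubgroup
    [∀ j, Finite (galoisCohomology ((ρ j).subrepresentation (Fil j) (hΓ j)) 1)]
    {g : ∀ a b, ((ρ a).subrepresentation (Fil a) (hΓ a)).toContRepresentation →ⁱL
      ((ρ b).subrepresentation (Fil b) (hΓ b)).toContRepresentation}
    (hg : ∀ a b (x : Fil a), (g a b x : W b) = f a b x)
    {x : Π j, galoisCohomology (ρ j) 1}
    (hx : x ∈ compatibleFamilies (H := fun j ↦ galoisCohomology (ρ j) 1) (fun j ↦ galoisCohomology.map (f (j + 1) j) 1))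
    (hC : ∀ j, x j ∈ (ρ j).strictSubgroup (Fil j) (hΓ j)) :
    ∃ η ∈ compatibleFamilies (H := fun j ↦ galoisCohomology ((ρ j).subrepresentation (Fil j) (hΓ j)) 1)
        (fun j ↦ galoisCohomology.map (g (j + 1) j) 1),
      ∀ j, cohomologyMap (subtypeHom (ρ j) (Fil j) (hΓ j)) 1 (η j) = x j := by
  refine exists_mem_compatibleFamilies_of_forall_mem
    (H := fun j ↦ galoisCohomology ((ρ j).subrepresentation (Fil j) (hΓ j)) 1)
    (fun j ↦ galoisCohomology.map (g (j + 1) j) 1)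
    (fun j ↦ {η | cohomologyMap (subtypeHom (ρ j) (Fil j) (hΓ j)) 1 η = x j}) (fun j ↦ ?_) (fun j w hw ↦ ?_)
  · obtain ⟨η, hη⟩ := (mem_strictSubgroup_iff_exists_map_subtypeHom_eq j (x j)).mp (hC j)
    exact ⟨η, hη⟩
  · change cohomologyMap (subtypeHom (ρ j) (Fil j) (hΓ j)) 1 (galoisCohomology.map (g (j + 1) j) 1 w) = x j
    rw [← map_subtypeHom_eq_subtypeHom_map hg (j + 1) j, Set.mem_setOf_eq.mp hw,
      (mem_compatibleFamilies_iff _ x).mp hx j]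

end Cohomology

end Tower

end Literature.NumberTheory.EllipticCurves

end
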